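import Summits.BirchSwinnertonDyer.BirchSwinnertonDyer.Theses.SelmerRank
import HarnessLib

/-!
# Route `SelmerRank`: the join `Assembly` BY NAME (item stmt-BirchSwinnertonDyer-0128)

The route's assembly item
`Summit.BirchSwinnertonDyer.BirchSwinnertonDyer.Theses.SelmerRank.Assembly :=
  (∀ (W : WeierstrassCurve ℚ), W.selmerCorank_eq_mordellWeilRank_add) →
    (∀ (W : WeierstrassCurve ℚ) [W.IsElliptic], ∃ p : ℕ, p.Prime ∧ W.selmerCorank p = W.analyticRank ∧ W.shaCorank p = 0) →
    BirchSwinnertonDyer`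
is pure bookkeeping algebra, as its docstring says: GIVEN the corank identity
`corank Sel_{p^∞}(E/ℚ) = rank E(ℚ) + corank Ш(E/ℚ)[p^∞]` (the named fact
`WeierstrassCurve.selmerCorank_eq_mordellWeilRank_add`, Greenberg 1999 §1 — taken here as the first
HYPOTHESIS, not used as a fact) and, for every elliptic `W`, ONE prime `p` with
`corank Sel_{p^∞} = r_an` and `corank Ш[p^∞] = 0`, rewrite to `r_an = rank E(ℚ)`, which is the summit
statement `BirchSwinnertonDyer = Literature.BSDRankConjecture` (`∀ W, W.IsElliptic → W.analyticRank =
W.mordellWeilRank`). Nothing is asserted: both hypotheses stay hypotheses of `Assembly`; no crux of the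
route is advanced and BSD is not proved by this. The algebra is ALREADY in the tree as
`Literature.BSD.selmerCorank_identity_imp_thesis_imp_bsd` (`Theorems/SelmerRankAssembly.lean`, which the
route file imports and whose statement is this chain spelled out); this LEAF file (it imports the route
file, nothing imports it) only restates that theorem at the literal type of the route decl `Assembly`, so
the item closes by name.
-/

set_option autoImplicit false
set_option linter.dupNamespace false

namespace Summit.BirchSwinnertonDyer.BirchSwinnertonDyer.Theorems

/-- **The join of route `SelmerRank` holds**: the Selmer corank identity (as a hypothesis) and, for
each elliptic `W`, a prime `p` with `corank_{ℤ_p} Sel_{p^∞}(E/ℚ) = r_an(E)` and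
`corank_{ℤ_p} Ш(E/ℚ)[p^∞] = 0` give `r_an(E) = rank E(ℚ)` for every `E/ℚ`, i.e. the summit statement
`BirchSwinnertonDyer` — by `r_an = corank Sel = rank + corank Ш = rank + 0`
(`Literature.BSD.selmerCorank_identity_imp_thesis_imp_bsd`, re-typed at the route decl). [folklore] -/
theorem selmerRank_assembly_proof :
    Summit.BirchSwinnertonDyer.BirchSwinnertonDyer.Theses.SelmerRank.Assembly :=
  Literature.BSD.selmerCorank_identity_imp_thesis_imp_bsd

end Summit.BirchSwinnertonDyer.BirchSwinnertonDyer.Theorems
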